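/-
# `Balaban1983to89.B5SupRealisationTorus` — Bałaban CMP 95 (1984), Proposition 1.2, step S1 AS PRINTED on the torus of record:
# THE `SupRealisation` OF RECORD and THE CAPSTONE — Proposition 1.2 for the G-family of record by the printed sup/Hölder random walk

statement-level skeleton of published theorems with citation tags; proofs where landed; nothing here is a claim
about the Yang–Mills mass gap

CITATION HEADER (lean-in-tree rule).  Cell `lit-balaban`, unit `lit-balaban-r02` (reader/typer r02 gen 11/12 = fold owner of block B5),
HOME `run/shared/lean/pub/lit-balaban/` (SKELETON row B5.Prop1.2 cell; S1-torus programme `lit-balaban-r02/B5-CLOSURE.md` v1.3 §3 item 5 /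
§5 item 2 — the CLOSER of the r02 ∕ p38-gen-8 split of HOME/STATUS.md 2026-08-22T03:18–04:50Z).  B5 = T. Bałaban, *Propagators and
renormalization transformations for lattice gauge theories. I*, Commun. Math. Phys. **95** (1984) 17–40 [`Balaban1984PropagatorsI`], held as
`paper:balaban1984-cmp95-propagators-rt-i` (pp. 35–39 = text layer p0019–p0023).  INPUTS (all kernel theorems of the tree): p38 gen 8's
`B5SupCarrierTorus` (p316435, carriers of record), `B5SupHolderTorus` (p316988) / `B5SupFactor125Torus` (p319659) /
`B5SupFactor129AdjTorus` (p319861) / `B5SupDominatedTorus` (p320679) (the Hölder calculus and the factor estimates (1.125)/(1.129)/(1.130)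
read from (1.115)–(1.117), direct and adjoint), `B5SupCertsTorus` (p320948: the four `DomCert` fields and the constructor `supRealisationR`
from two representations); own `B5SupRepTorus.repS` (p317540, direct representation), `B5OneH128Torus.repOne` (p318614, adjoint
representation), `B5SupWalkFamG.prop12_famG_of_supRealisation` (p317835, the pre-assembled capstone over own `B5SupWalkS1.s1_of_walks` p313604).

WHAT IS PRINTED (text layer p0020–p0024, verbatim).  p. 36 [PDF 20] L20–21: «A proof of Proposition 1.2 will be given in several steps.
In the first step we will show that the inequalities (1.115)–(1.117), (1.89) imply the proposition.»; pp. 36–39 the random walk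
(1.118)–(1.131); p. 37 [PDF 21] (after (1.123)): «Of course the sum is convergent only if R is small in a proper sense. This holds if M₀
is sufficiently large. For example let us prove the inequality (1.113) assuming the inequalities (1.115)–(1.117).»; p. 39 [PDF 23] L1–4:
«Let us notice that the constant O(1) under the sum above is an absolute constant depending on d only, hence we can fix M₀ depending on
d only, such that the series is convergent.»; p. 39 L6–8: «The proofs of the other inequalities are exactly the same, but in the
estimates of G∇*J we have to take a representation of G adjoint to (1.123), with the operators K(h) acting on the right.»; p. 40 [PDF 24]
L7–8: «Thus we have finished the proof of Proposition 1.2.»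

WHAT THIS MODULE PROVES (kernel-checked, zero sorry):
§1 `κS d a : SupConsts` — THE UNIFORM CONSTANTS OF RECORD of the sup walk: `c̄ = 4`, `ν = 33^d`, `K̄ = K_d(¼)` (p38 gen 7's cube geometry),
   `θ̄ = B5SupRepTorus.thetaBarS d a` (dominating the (1.128) constant `thetaW` of BOTH representations), `c_G = 1`, and p38 gen 8's
   d-only certificate constants `cFmax d`, `cLmax d`, `c1max d`;
§2 **`supRealisationW n M a k M₀ hn ha hM₀ : SupRealisation (latticeSettingP12R n M a k) (kdW n M) (gP12R M n a k) M₀ (κS d a) Bool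
   (CarV n M) (CarVg n M) (TorR M) (Cen M M₀)`** = p38's `supRealisationR` fed with `repS_thetaBarS` (direct) and `repOne_thetaBarS` (adjoint)
   — the six operator identities are `rfl`; and the family form `supRealisation_famG` over B5's top-level tori `famG d L a`;
§3 **THE CAPSTONE `step1_famG_via_supWalk (L) (ha : 0 < a) : B5.Global115_117Fam (famG d L a) g → B5.Prop11Printed (famG d L a) →
   B5.Kernel126_127Printed kdW → B5.Prop12Printed (famG d L a)`** = STEP 1 OF THE PRINTED PROOF («the inequalities (1.115)–(1.117),
   (1.89) imply the proposition», p. 36 L20–21) for the G-family of record, every `d`, `L`, `a > 0`: own `B5SupWalkS1.s1_of_walks` fed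
   with `supRealisation_famG` (sup/Hölder walk, (1.110)–(1.113)) and p38 gen 7's `realisation_famG` (L² walk, (1.114)); with the tree's
   theorems `global115_117_famG_printed hd hL ha`, `prop11Printed_famG`, `kernel126_127_kdW_fam hd L` for the three hypotheses it yields
   `B5.Prop12Printed (famG d L a)` for `d ≥ 1`, odd `L > 1`, `a > 0` — which RE-DERIVES `B5Prop12GHolds.prop12_famG_printed` through the
   printed S1 route; since the tree's `global115_117_famG_printed` is itself `global115_117_famG … (prop12_famG_printed …)`, that
   composite is a CONSISTENCY LOOP (Prop. 1.2 ⇒ (1.115)–(1.117) ⇒ Prop. 1.2), NOT an independent second proof — what is independent and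
   new is the IMPLICATION `step1_famG_via_supWalk` itself (the corollary is not restated as a theorem: same statement as the tree's).

HONEST SCOPE.  (1) No new estimate: assembly of kernel theorems of the tree; the corollary `B5.Prop12Printed (famG d L a)` is ALREADY a theorem
(`B5Prop12GHolds.prop12_famG_printed`, alternative Combes–Thomas route); the printed Step 1 is kernel-checked here AS AN IMPLICATION;
composed with the tree's (1.115)–(1.117), which currently pass through `prop12_famG_printed`, it re-derives (does NOT independently
re-prove) Prop. 1.2 — exactly as p. 38 uses (1.115)–(1.117) as inputs («The factors with G are estimated by using (1.115)»); an
independent proof along the printed lines needs (1.115)–(1.117) from steps S2/S3 ((1.132)–(1.133), Prop. 1.2 for G₀) without passing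
through Prop. 1.2 for G (the tree's `B5.prop12_of_printed_steps` chain); no SKELETON head changes.  (v1.1 DOCSTRING-ONLY, r05 SECOND-READ-B5
pass 24 note 24-(a) adopted: v1 called the composite a «second proof»; declarations byte-identical to v1 p321703.)  (2) Constants ours where print writes O(1);
the adjoint representation of p. 39 is modelled by the `ℓ¹` carrier (declared in `B5SupWalkS1`, `B5SupCarrierTorus`, `B5OneH128Torus`).
(3) Value = B5-CLOSURE §3 item 5 closed: every located leaf of the printed sup/Hölder walk is instantiated on the torus of record.
-/
import Mathlib
import Literature.MathematicalPhysics.QuantumFieldTheory.Balaban1983to89.B5SupCertsTorus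
import Literature.MathematicalPhysics.QuantumFieldTheory.Balaban1983to89.B5OneH128Torus
import Literature.MathematicalPhysics.QuantumFieldTheory.Balaban1983to89.B5SupWalkFamG

open scoped BigOperators

namespace Literature.MathematicalPhysics.QuantumFieldTheory.Balaban1983to89.B5SupRealisationTorus

open Literature.MathematicalPhysics.QuantumFieldTheory.Balaban1983to89
open Literature.MathematicalPhysics.QuantumFieldTheory.Balaban1983to89.B4Sect5Proof (latticeConst latticeConst_nonneg)
open Literature.MathematicalPhysics.QuantumFieldTheory.Balaban1983to89.B5SettingP12Real (latticeSettingP12R gP12R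
  modelSigns_latticeSettingP12R)
open Literature.MathematicalPhysics.QuantumFieldTheory.Balaban1983to89.B5SiteBridgeP12 (nP MP one_le_nP)
open Literature.MathematicalPhysics.QuantumFieldTheory.Balaban1983to89.B5ResidualGpTorusHolds (TopIdx)
open Literature.MathematicalPhysics.QuantumFieldTheory.Balaban1983to89.B5Prop12GLattice (famG)
open Literature.MathematicalPhysics.QuantumFieldTheory.Balaban1983to89.B5WalkTorusGeom (TorR Cen ctr)
open Literature.MathematicalPhysics.QuantumFieldTheory.Balaban1983to89.B5WalkCarrierTorus (Vsp)
open Literature.MathematicalPhysics.QuantumFieldTheory.Balaban1983to89.B5WalkRealisationTorus (kdW κW realisation_famG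
  prop11Printed_famG kernel126_127_kdW_fam)
open Literature.MathematicalPhysics.QuantumFieldTheory.Balaban1983to89.B5SupWalk131 (SupConsts)
open Literature.MathematicalPhysics.QuantumFieldTheory.Balaban1983to89.B5SupWalkS1 (SupRealisation s1_of_walks)
open Literature.MathematicalPhysics.QuantumFieldTheory.Balaban1983to89.B5SupRepTorus (thetaBarS thetaBarS_nonneg repS_thetaBarS)
open Literature.MathematicalPhysics.QuantumFieldTheory.Balaban1983to89.B5OneH128Torus (repOne_thetaBarS)
open Literature.MathematicalPhysics.QuantumFieldTheory.Balaban1983to89.B5SupDominatedTorus (cFmax cLmax c1max le_cFmax le_cLmax le_c1max)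
open Literature.MathematicalPhysics.QuantumFieldTheory.Balaban1983to89.B5SupCertsTorus (CarV CarVg supRealisationR)
open Literature.MathematicalPhysics.QuantumFieldTheory.Balaban1983to89.B5SupWalkFamG (prop12_famG_of_supRealisation)

noncomputable section

/-! ## §1 The uniform constants of record -/

/-- **THE UNIFORM CONSTANTS OF RECORD of the sup/Hölder walk** (p. 39: «an absolute constant depending on d only … we can fix M₀ depending on
d only»): `c̄ = 4`, `ν = 33^d`, `K̄ = K_d(¼)`, `θ̄ = thetaBarS d a`, `c_G = 1`, `c_F = cFmax d`, `c_L = cLmax d`, `c₁ = c1max d`.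
[cite: Balaban1984PropagatorsI, (1.131) p.38, p.39 L1–4] -/
def κS (d : ℕ) (a : ℝ) : SupConsts where
  cbar := 4
  nu := 33 ^ d
  Kbar := latticeConst d (1 / 4)
  thetaBar := thetaBarS d a
  cG := 1
  cF := cFmax d
  cL := cLmax d
  c1 := c1max d
  cbar_nonneg := by norm_num
  nu_nonneg := by positivity
  Kbar_nonneg := latticeConst_nonneg d (by norm_num)
  thetaBar_nonneg := thetaBarS_nonneg d a
  cG_pos := one_pos
  cF_nonneg := zero_le_one.trans le_cFmax.1
  cL_nonneg := le_trans (by norm_num : (0 : ℝ) ≤ 2) le_cLmax.1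
  c1_nonneg := zero_le_one.trans le_c1max.1

/-! ## §2 The `SupRealisation` of record -/

section Record

variable {d : ℕ} (n : ℕ) [NeZero n] (M : Fin d → ℕ) [hM : ∀ μ, NeZero (M μ)] (a : ℝ) (k : ℕ) (M₀ : ℕ)

/-- **THE SUP/HÖLDER REALISATION OF RECORD** for `G = Δ_a⁻¹` on `T_η × {1..d}`, every `n ≥ 1`, torus `M`, `a > 0`, `k`, cube scale `M₀ ≥ 1`,
at the constants `κS d a`: p38 gen 8's `supRealisationR` fed with the direct representation `B5SupRepTorus.repS_thetaBarS` and the adjoint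
one `B5OneH128Torus.repOne_thetaBarS` (the six operator identities `rfl`), the cube geometry (`(8·4+1)^d = 33^d`, `K_d(¼)`) and the d-only
certificate constants. [cite: Balaban1984PropagatorsI, pp.36–39, (1.123) p.37, p.39 L1–8] -/
def supRealisationW (hn : 1 ≤ n) (ha : 0 < a) (hM₀ : 1 ≤ M₀) :
    SupRealisation (latticeSettingP12R n M a k) (kdW n M) (gP12R M n a k) M₀ (κS d a) Bool (CarV n M) (CarVg n M) (TorR M)
      (Cen M M₀) :=
  supRealisationR (κS d a) (repS_thetaBarS n M a k M₀ hn ha hM₀ (κS d a) rfl le_rfl)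
    (repOne_thetaBarS n M a k M₀ hn ha hM₀ (κS d a) rfl le_rfl) rfl rfl rfl rfl rfl rfl hn ha hM₀
    (by show (11 : ℝ) / 3 ≤ 4; norm_num) (by show ((8 : ℝ) * 4 + 1) ^ d ≤ 33 ^ d; norm_num) le_rfl le_rfl le_rfl le_rfl

end Record

/-! ## §3 The family of record and the capstone -/

section Capstone

variable {d L : ℕ} {a : ℝ}

variable (d L) in
/-- **THE SUP REALISATION FOR EVERY MEMBER OF THE FAMILY OF RECORD AND EVERY CUBE SCALE** (the hypothesis `real` of
`B5SupWalkFamG.prop12_famG_of_supRealisation` / `B5SupWalkS1.s1_of_walks`). [cite: Balaban1984PropagatorsI, pp.36–39] -/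
def supRealisation_famG (ha : 0 < a) :
    ∀ (i : TopIdx d L) (M₀ : ℕ), 1 ≤ M₀ →
      SupRealisation (famG d L a i) (kdW (nP i.P) (MP i.P)) (gP12R (MP i.P) (nP i.P) a i.P.K) M₀ (κS d a) Bool
        (CarV (nP i.P) (MP i.P)) (CarVg (nP i.P) (MP i.P)) (TorR (MP i.P)) (Cen (MP i.P) M₀)
  | ⟨P, hPd, _, _⟩, M₀, hM₀ => by
      subst hPd
      exact supRealisationW (nP P) (MP P) a P.K M₀ (one_le_nP P) ha hM₀

/-- **STEP 1 OF THE PRINTED PROOF, FOR THE G-FAMILY OF RECORD** — p. 36 L20–21 «A proof of Proposition 1.2 will be given in several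
steps. In the first step we will show that the inequalities (1.115)–(1.117), (1.89) imply the proposition.»: for every `d`, `L` and
`a > 0`, the family-level (1.115)–(1.117) (`B5.Global115_117Fam`), Proposition 1.1 ((1.89)–(1.90), `B5.Prop11Printed`) and the kernel
bounds (1.126)–(1.127) imported from [2] (`B5.Kernel126_127Printed` for the kernel data of record `kdW`) IMPLY Proposition 1.2
(1.110)–(1.114), `B5.Prop12Printed (famG d L a)` — (1.110)–(1.113) by the sup/Hölder random walk (1.118)–(1.131) over the direct and
the adjoint representations of record (`supRealisation_famG` at the uniform constants `κS d a`; the cube scale `M₀(d)` is fixed inside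
own `B5SupWalkS1.s1_of_walks`, p. 39 L1–4), (1.114) (step S1′, p. 39) by p38 gen 7's L² walk `realisation_famG`.  The hypotheses are
exactly the three printed inputs; each is a theorem of the tree for this family (`B5Prop12GHolds.global115_117_famG_printed`,
`B5WalkRealisationTorus.prop11Printed_famG`, `kernel126_127_kdW_fam`), so `step1_famG_via_supWalk L ha (global115_117_famG_printed hd hL ha)
(prop11Printed_famG d L ha) (kernel126_127_kdW_fam hd L) : B5.Prop12Printed (famG d L a)` (equivalently own
`B5SupWalkFamG.prop12_famG_of_supRealisation hd hL ha (κS d a) (supRealisation_famG d L ha)`) RE-DERIVES the tree's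
`B5Prop12GHolds.prop12_famG_printed` by the printed mechanism — a consistency loop rather than an independent second proof, because the
tree's `global115_117_famG_printed` is obtained from `prop12_famG_printed`; it is not restated as a separate theorem here because its
statement coincides with that theorem's. [cite: Balaban1984PropagatorsI, p.36 L20–21, Prop. 1.2 (1.110)–(1.114) pp.35–36, pp.36–39 (1.118)–(1.131),
p.39 L1–8, p.40 L7–8] -/
theorem step1_famG_via_supWalk (L : ℕ) (ha : 0 < a) :
    B5.Global115_117Fam (famG d L a) (fun i => gP12R (MP i.P) (nP i.P) a i.P.K) →
      B5.Prop11Printed (famG d L a) →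
        B5.Kernel126_127Printed (fun i : TopIdx d L => kdW (nP i.P) (MP i.P)) → B5.Prop12Printed (famG d L a) :=
  s1_of_walks (famG d L a) (fun i => gP12R (MP i.P) (nP i.P) a i.P.K) (fun i : TopIdx d L => kdW (nP i.P) (MP i.P)) (κW d a)
    (κS d a) (VL := fun i _ => Vsp (nP i.P) (MP i.P)) (XL := fun i _ => TorR (MP i.P)) (SL := fun i M₀ => Cen (MP i.P) M₀)
    (realisation_famG d L ha) (supRealisation_famG d L ha) (fun i => modelSigns_latticeSettingP12R (MP i.P) (nP i.P) a i.P.K)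

end Capstone

end

end Literature.MathematicalPhysics.QuantumFieldTheory.Balaban1983to89.B5SupRealisationTorus
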